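import Mathlib
import Literature.AlgebraicGeometry.Resolution.WeightedResolutionDatum
import Summits.ResolutionOfSingularities.ResolutionOfSingularities.Theorems.WeightedInvariantHypersurfaceLocalGameEFT4S
import Summits.ResolutionOfSingularities.ResolutionOfSingularities.Theorems.WeightedInvariantHypersurfaceLocalGameEFT4SDimLETwo

/-!
# THE POSITION-DIMENSION LADDER OF THE KEY `LocalWeightedDropEFT4S`, TYPED ONCE — the rung `PRung d p ι J` for every
# Krull-dimension bound `d : ℕ` (door `HypersurfaceCentreConstruction`, stmt-ResolutionOfSingularities-19897, line
# `local-engine`, ORDER (o29) of the registrar res-L1-w43-plan-1, HOME/STATUS 2026-08-27T09:57:17Z; typer res-type-061)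

The PARAMETRIC form of the P2 rung statement module `…HypersurfaceLocalGameEFT4SDimLETwo` (res-type-073, p512950): the
three position-dependent clauses of `LocalWeightedDropEFT4S p` (`…HypersurfaceLocalGameEFT4S`, p504475) —
`IotaJEssSmoothCompatible` (c11), `CanonicalGameClause` (c9′), `JOpenPresentationForallSing` (open″) — with EVERY
regular-local-ring binder restricted to Krull dimension `≤ d` EXACTLY where the LE2 module writes `≤ 2`, and nothing else
changed; the conjunction `PRung d p ι J` of the ten clauses (same shape and order as `P2Rung`); the ∃-closed rung
`LocalWeightedDropEFT4SDimLE d p := ∃ ι J, PRung d p ι J`; the named third rung `P3Rung p ι J := PRung 3 p ι J`; and four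
sorry-free seams: `pRung_of_clauses` (unrestricted clauses ⇒ every rung), `pRung_of_eft4S_witness` (a witness of the KEY is
a witness of every rung), `pRung_mono` (`d ≤ d'` ⇒ rung `d'` ⇒ rung `d`), `pRung_two_iff` (`PRung 2 p ι J ↔ P2Rung p ι J`,
so the P2 rung of record transfers by `Iff`).  Definitions and plumbing only; NO mathematics.

[OURS · candidates · conjecture-grade design objects; nothing here asserts anything about Hironaka's problem; NOT a statement
of the manuscript under review (Hironaka 2017, [claim: Hironaka2017, status: under-review]); AI planning/typing, weaker than
expert review.]

## Purpose (registrar's words, ORDER (o29))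

«Every rung of the KEY's ladder becomes a nameable target (`stub_keyRung_dimLE d`): P2 = `d = 2` closes today
(res-type-073's assembly of `P2Rung p iotaOrd jContact`, transferred here by `pRung_two_iff`), P3 = `d = 3` is the next
registered rung once `ι₃` is designed; the triagers get a fixed statement to probe.»  Regime P3 = surfaces in smooth
threefolds: `J :=` the cylinder rule of ORDER (o28) (res-type-005 / res-D-brk-1), `ι :=` TO BE DESIGNED (`iotaOrd` alone
fails at Krull dimension 3: res-type-073's specimens p506015 / p507306).  Dimension `d = 1` is the P1 rung territory of
ORDER (o23) (res-type-005), `d = 0` is vacuous.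
-/

set_option linter.dupNamespace false

noncomputable section

open IsLocalRing Literature.AlgebraicGeometry.Resolution

namespace Summit.ResolutionOfSingularities.ResolutionOfSingularities.Cruxes.HypersurfaceCentreConstruction.LocalEngine

/-! ## The three position-dependent clauses at Krull dimension `≤ d` -/

/-- (c11)↾≤d: `IotaJEssSmoothCompatible` with the TARGET `S'` of Krull dimension `≤ d`.  Body verbatim otherwise; at
`d = 2` this is `IotaJEssSmoothCompatibleLE2` (`pRung_two_iff`). [OURS · candidate clause of the rung `PRung d` ·
registrar res-L1-w43-plan-1, ORDER (o29)] -/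
def IotaJEssSmoothCompatibleLE (d : ℕ) (ι : (R : Type) → [CommRing R] → R → Ordinal.{0})
    (J : (R : Type) → [CommRing R] → R → ℕ → Ideal R) : Prop :=
  ∀ (S S' : Type) [CommRing S] [IsRegularLocalRing S] [CommRing S'] [IsRegularLocalRing S'] [Algebra S S']
    [IsLocalHom (algebraMap S S')] [Algebra.FormallySmooth S S'] [Algebra.EssFiniteType S S'] (f : S),
    ringKrullDim S' ≤ d →
    ι S' (algebraMap S S' f) = ι S f ∧ ∀ m : ℕ, J S' (algebraMap S S' f) m = (J S f m).map (algebraMap S S')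

/-- (c9′)↾≤d: `CanonicalGameClause` at positions `S` of Krull dimension `≤ d`.  Body verbatim; at `d = 2` this is
`CanonicalGameClauseLE2`. [OURS · candidate clause of the rung `PRung d` · registrar res-L1-w43-plan-1, ORDER (o29)] -/
def CanonicalGameClauseLE (d p : ℕ) (ι : (R : Type) → [CommRing R] → R → Ordinal.{0})
    (J : (R : Type) → [CommRing R] → R → ℕ → Ideal R) : Prop :=
  ∀ (k₀ : Type) [Field k₀] [CharP k₀ p] [PerfectField k₀]
    (S : Type) [CommRing S] [Algebra k₀ S] [Algebra.EssFiniteType k₀ S] [IsRegularLocalRing S]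
    (f : S), ringKrullDim S ≤ d → f ≠ 0 → f ∈ (maximalIdeal S) ^ 2 →
    ∃ (P : Ideal S), P.IsPrime ∧ IsRegularLocalRing (S ⧸ P) ∧ f ∈ P ∧
      (∀ (𝔭 : Ideal S) [𝔭.IsPrime], f ∈ 𝔭 →
        (ι (Localization.AtPrime 𝔭) (algebraMap S (Localization.AtPrime 𝔭) f) = ι S f ↔ P ≤ 𝔭)) ∧
      (∀ (𝔭 : Ideal S) [𝔭.IsPrime], f ∈ 𝔭 → P ≤ 𝔭 → ∀ m : ℕ,
        J (Localization.AtPrime 𝔭) (algebraMap S (Localization.AtPrime 𝔭) f) m =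
          (J S f m).map (algebraMap S (Localization.AtPrime 𝔭))) ∧
      ∃ (n : ℕ) (u : Fin n → S) (w : Fin n → ℕ),
        Ideal.span (Set.range u) = maximalIdeal S ∧ (maximalIdeal S).spanFinrank = n ∧ (∃ i, 0 < w i) ∧
        Ideal.span {x | ∃ i, 0 < w i ∧ x = u i} = P ∧
        (∀ m : ℕ, weightedMonomialIdeal u w m = J S f m) ∧
        (∀ (Q : Ideal S) [Q.IsPrime], P ≤ Q →
          algebraMap S (Localization.AtPrime Q) f ∈ (maximalIdeal (Localization.AtPrime Q)) ^ 2) ∧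
        ∀ (𝔫 : Ideal (cobordantAlgebra' u w)) [𝔫.IsPrime],
          cobordantT' u w ∈ 𝔫 →
          P.map (algebraMap S (cobordantAlgebra' u w)) ≤ 𝔫 →
          ¬ (extReesAlgebra.vertexIdeal (weightedMonomialIdeal u w) ≤ 𝔫) →
          ∀ (a : ℕ) (g : cobordantAlgebra' u w),
            algebraMap S (cobordantAlgebra' u w) f = cobordantT' u w ^ a * g →
            ¬ (cobordantT' u w ∣ g) →
            algebraMap (cobordantAlgebra' u w) (Localization.AtPrime 𝔫) g ∈
              (maximalIdeal (Localization.AtPrime 𝔫)) ^ 2 →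
            ι (Localization.AtPrime 𝔫) (algebraMap (cobordantAlgebra' u w) (Localization.AtPrime 𝔫) g) < ι S f

/-- (open″)↾≤d: `JOpenPresentationForallSing` for model primes `𝔪` with `A_𝔪` of Krull dimension `≤ d`, the stratum /
presentation demands being made only at primes `𝔮 ∈ D(h)` with `A_𝔮` of Krull dimension `≤ d`.  Body verbatim
otherwise; at `d = 2` this is `JOpenPresentationForallSingLE2`. [OURS · candidate clause of the rung `PRung d` ·
registrar res-L1-w43-plan-1, ORDER (o29)] -/
def JOpenPresentationForallSingLE (d p : ℕ) (ι : (R : Type) → [CommRing R] → R → Ordinal.{0})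
    (J : (R : Type) → [CommRing R] → R → ℕ → Ideal R) : Prop :=
  ∀ (k₀ : Type) [Field k₀] [CharP k₀ p] [PerfectField k₀]
    (A : Type) [CommRing A] [Algebra k₀ A] [Algebra.FiniteType k₀ A] (𝔪 : Ideal A) [𝔪.IsPrime] (F : A),
    IsRegularLocalRing (Localization.AtPrime 𝔪) →
    ringKrullDim (Localization.AtPrime 𝔪) ≤ d →
    algebraMap A (Localization.AtPrime 𝔪) F ≠ 0 →
    algebraMap A (Localization.AtPrime 𝔪) F ∈ (maximalIdeal (Localization.AtPrime 𝔪)) ^ 2 →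
    ∃ h : A, h ∉ 𝔪 ∧ ∃ (N : ℕ) (U : Fin N → A) (W : Fin N → ℕ), (∀ i, 0 < W i) ∧
      (∃ hU : ∀ i, algebraMap A (Localization.AtPrime 𝔪) (U i) ∈ maximalIdeal (Localization.AtPrime 𝔪),
        LinearIndependent (ResidueField (Localization.AtPrime 𝔪))
          (fun i => ((maximalIdeal (Localization.AtPrime 𝔪)).toCotangent ⟨_, hU i⟩ :
            CotangentSpace (Localization.AtPrime 𝔪)))) ∧
      ∀ (𝔮 : Ideal A) [𝔮.IsPrime], h ∉ 𝔮 → ringKrullDim (Localization.AtPrime 𝔮) ≤ d →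
        ((∀ i, U i ∈ 𝔮) ↔
          (algebraMap A (Localization.AtPrime 𝔮) F ∈ (maximalIdeal (Localization.AtPrime 𝔮)) ^ 2 ∧
            ι (Localization.AtPrime 𝔮) (algebraMap A (Localization.AtPrime 𝔮) F) =
              ι (Localization.AtPrime 𝔪) (algebraMap A (Localization.AtPrime 𝔪) F))) ∧
        ((∀ i, U i ∈ 𝔮) → ∀ m : ℕ,
          J (Localization.AtPrime 𝔮) (algebraMap A (Localization.AtPrime 𝔮) F) m =
            (weightedMonomialIdeal U W m).map (algebraMap A (Localization.AtPrime 𝔮)))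

/-! ## The rung `PRung d`, its ∃-closure, and the named third rung -/

/-- THE RUNG AT KRULL DIMENSION `≤ d` for a pair `(ι, J)`: the ten clauses of `LocalWeightedDropEFT4S p` with the three
position-dependent clauses restricted to Krull dimension `≤ d` (same order as `P2Rung`).  Registrar's target shape:
`stub_keyRung_dimLE d : ∀ p, p.Prime → ∃ ι J, PRung d p ι J` (or for a NAMED pair).  A BC5-type rung of the key, not a
claim about the key itself; `d = 2` is `P2Rung` (`pRung_two_iff`), `d ≥ 3` is the open regime P3.
[OURS · candidate · registrar res-L1-w43-plan-1, ORDER (o29)] -/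
def PRung (d p : ℕ) (ι : (R : Type) → [CommRing R] → R → Ordinal.{0})
    (J : (R : Type) → [CommRing R] → R → ℕ → Ideal R) : Prop :=
  IotaIsoInvariant ι ∧ IotaGenerizationMonotone ι ∧ IotaUpperSemicontinuous ι ∧ IotaTorusFactorMonotone ι ∧
  JIsoInvariant J ∧ IotaJEssSmoothCompatibleLE d ι J ∧ CanonicalGameClauseLE d p ι J ∧
  JOpenPresentationForallSingLE d p ι J ∧ IotaUnitInvariant ι ∧ JUnitInvariant J

/-- THE ∃-CLOSED RUNG AT KRULL DIMENSION `≤ d`: some pair `(ι, J)` satisfies `PRung d p ι J` — the KEY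
`LocalWeightedDropEFT4S p` with its three position-dependent clauses restricted to positions / targets / model primes of
Krull dimension `≤ d`.  Implied by the KEY for every `d` (`localWeightedDropEFT4SDimLE_of_eft4S`) and antitone in `d`
(`localWeightedDropEFT4SDimLE_mono`). [OURS · candidate · registrar res-L1-w43-plan-1, ORDER (o29)] -/
def LocalWeightedDropEFT4SDimLE (d p : ℕ) : Prop :=
  ∃ (ι : (R : Type) → [CommRing R] → R → Ordinal.{0}) (J : (R : Type) → [CommRing R] → R → ℕ → Ideal R),
    PRung d p ι J

/-- THE P3 RUNG (named): `P3Rung p ι J := PRung 3 p ι J` — «P3 = surfaces in smooth threefolds: `J :=` the cylinder rule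
of ORDER (o28) (`(jContact (R_P) f m) ∩ R` along the codimension-2 regular stratum `V(P)`; res-type-005 / res-D-brk-1),
`ι :=` TO BE DESIGNED (`iotaOrd` alone fails at Krull dimension 3: res-type-073's specimens p506015 / p507306)».  The next
registered rung of the KEY's ladder once `ι₃` is designed; nothing about it is claimed here.
[OURS · candidate · registrar res-L1-w43-plan-1, ORDER (o29)] -/
def P3Rung (p : ℕ) (ι : (R : Type) → [CommRing R] → R → Ordinal.{0})
    (J : (R : Type) → [CommRing R] → R → ℕ → Ideal R) : Prop :=
  PRung 3 p ι J

/-! ## Seams (sorry-free plumbing) -/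

/-- The unrestricted clauses give every rung (so the KEY implies `PRung d` for every `d`). [OURS · seam · ORDER (o29)] -/
theorem pRung_of_clauses (d p : ℕ) (ι : (R : Type) → [CommRing R] → R → Ordinal.{0})
    (J : (R : Type) → [CommRing R] → R → ℕ → Ideal R)
    (h1 : IotaIsoInvariant ι) (h2 : IotaGenerizationMonotone ι) (h3 : IotaUpperSemicontinuous ι)
    (h4 : IotaTorusFactorMonotone ι) (h5 : JIsoInvariant J) (h6 : IotaJEssSmoothCompatible ι J)
    (h7 : CanonicalGameClause p ι J) (h8 : JOpenPresentationForallSing p ι J) (h9 : IotaUnitInvariant ι)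
    (h10 : JUnitInvariant J) : PRung d p ι J := by
  refine ⟨h1, h2, h3, h4, h5, ?_, ?_, ?_, h9, h10⟩
  · intro S S' _ _ _ _ _ _ _ _ f _
    exact h6 S S' f
  · intro k₀ _ _ _ S _ _ _ _ f _ hf0 hf2
    exact h7 k₀ S f hf0 hf2
  · intro k₀ _ _ _ A _ _ _ 𝔪 _ F hreg _ hF0 hF2
    obtain ⟨h, hh, N, U, W, hW, hU, hq⟩ := h8 k₀ A 𝔪 F hreg hF0 hF2
    exact ⟨h, hh, N, U, W, hW, hU, fun 𝔮 _ hq𝔮 _ => hq 𝔮 hq𝔮⟩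

/-- A witness of the KEY `LocalWeightedDropEFT4S p` is a witness of the rung `PRung d p` for every `d`.
[OURS · seam · ORDER (o29)] -/
theorem pRung_of_eft4S_witness (d p : ℕ) (h : LocalWeightedDropEFT4S p) :
    ∃ (ι : (R : Type) → [CommRing R] → R → Ordinal.{0}) (J : (R : Type) → [CommRing R] → R → ℕ → Ideal R),
      PRung d p ι J := by
  obtain ⟨ι, J, h1, h2, h3, h4, h5, h6, h7, h8, h9, h10⟩ := h
  exact ⟨ι, J, pRung_of_clauses d p ι J h1 h2 h3 h4 h5 h6 h7 h8 h9 h10⟩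

/-- The KEY implies the ∃-closed rung at every dimension bound. [OURS · seam · ORDER (o29)] -/
theorem localWeightedDropEFT4SDimLE_of_eft4S (d p : ℕ) (h : LocalWeightedDropEFT4S p) :
    LocalWeightedDropEFT4SDimLE d p :=
  pRung_of_eft4S_witness d p h

/-- (c11)↾≤d is antitone in `d`. [OURS · seam · ORDER (o29)] -/
theorem iotaJEssSmoothCompatibleLE_mono {d d' : ℕ} (hdd' : d ≤ d')
    (ι : (R : Type) → [CommRing R] → R → Ordinal.{0}) (J : (R : Type) → [CommRing R] → R → ℕ → Ideal R)
    (h : IotaJEssSmoothCompatibleLE d' ι J) : IotaJEssSmoothCompatibleLE d ι J := by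
  intro S S' _ _ _ _ _ _ _ _ f hdim
  exact h S S' f (hdim.trans (by exact_mod_cast hdd'))

/-- (c9′)↾≤d is antitone in `d`. [OURS · seam · ORDER (o29)] -/
theorem canonicalGameClauseLE_mono {d d' : ℕ} (hdd' : d ≤ d') (p : ℕ)
    (ι : (R : Type) → [CommRing R] → R → Ordinal.{0}) (J : (R : Type) → [CommRing R] → R → ℕ → Ideal R)
    (h : CanonicalGameClauseLE d' p ι J) : CanonicalGameClauseLE d p ι J := by
  intro k₀ _ _ _ S _ _ _ _ f hdim hf0 hf2
  exact h k₀ S f (hdim.trans (by exact_mod_cast hdd')) hf0 hf2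

/-- (open″)↾≤d is antitone in `d` (both dimension hypotheses — on the model prime `𝔪` and on the probed primes `𝔮` —
occur in hypothesis position). [OURS · seam · ORDER (o29)] -/
theorem jOpenPresentationForallSingLE_mono {d d' : ℕ} (hdd' : d ≤ d') (p : ℕ)
    (ι : (R : Type) → [CommRing R] → R → Ordinal.{0}) (J : (R : Type) → [CommRing R] → R → ℕ → Ideal R)
    (h : JOpenPresentationForallSingLE d' p ι J) : JOpenPresentationForallSingLE d p ι J := by
  intro k₀ _ _ _ A _ _ _ 𝔪 _ F hreg hdim hF0 hF2
  obtain ⟨h₀, hh, N, U, W, hW, hU, hq⟩ := h k₀ A 𝔪 F hreg (hdim.trans (by exact_mod_cast hdd')) hF0 hF2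
  exact ⟨h₀, hh, N, U, W, hW, hU, fun 𝔮 _ hq𝔮 hdim𝔮 => hq 𝔮 hq𝔮 (hdim𝔮.trans (by exact_mod_cast hdd'))⟩

/-- **The ladder is antitone: rung `d'` gives rung `d` for `d ≤ d'`.** [OURS · seam · ORDER (o29)] -/
theorem pRung_mono {d d' : ℕ} (hdd' : d ≤ d') (p : ℕ)
    (ι : (R : Type) → [CommRing R] → R → Ordinal.{0}) (J : (R : Type) → [CommRing R] → R → ℕ → Ideal R)
    (h : PRung d' p ι J) : PRung d p ι J := by
  obtain ⟨h1, h2, h3, h4, h5, h6, h7, h8, h9, h10⟩ := h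
  exact ⟨h1, h2, h3, h4, h5, iotaJEssSmoothCompatibleLE_mono hdd' ι J h6, canonicalGameClauseLE_mono hdd' p ι J h7,
    jOpenPresentationForallSingLE_mono hdd' p ι J h8, h9, h10⟩

/-- The ∃-closed rung is antitone in `d`. [OURS · seam · ORDER (o29)] -/
theorem localWeightedDropEFT4SDimLE_mono {d d' : ℕ} (hdd' : d ≤ d') (p : ℕ)
    (h : LocalWeightedDropEFT4SDimLE d' p) : LocalWeightedDropEFT4SDimLE d p := by
  obtain ⟨ι, J, hr⟩ := h
  exact ⟨ι, J, pRung_mono hdd' p ι J hr⟩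

/-- (c11)↾≤2 of this module IS `IotaJEssSmoothCompatibleLE2` of the P2 module. [OURS · seam · ORDER (o29)] -/
theorem iotaJEssSmoothCompatibleLE_two_iff (ι : (R : Type) → [CommRing R] → R → Ordinal.{0})
    (J : (R : Type) → [CommRing R] → R → ℕ → Ideal R) :
    IotaJEssSmoothCompatibleLE 2 ι J ↔ IotaJEssSmoothCompatibleLE2 ι J :=
  Iff.rfl

/-- (c9′)↾≤2 of this module IS `CanonicalGameClauseLE2` of the P2 module. [OURS · seam · ORDER (o29)] -/
theorem canonicalGameClauseLE_two_iff (p : ℕ) (ι : (R : Type) → [CommRing R] → R → Ordinal.{0})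
    (J : (R : Type) → [CommRing R] → R → ℕ → Ideal R) :
    CanonicalGameClauseLE 2 p ι J ↔ CanonicalGameClauseLE2 p ι J :=
  Iff.rfl

/-- (open″)↾≤2 of this module IS `JOpenPresentationForallSingLE2` of the P2 module. [OURS · seam · ORDER (o29)] -/
theorem jOpenPresentationForallSingLE_two_iff (p : ℕ) (ι : (R : Type) → [CommRing R] → R → Ordinal.{0})
    (J : (R : Type) → [CommRing R] → R → ℕ → Ideal R) :
    JOpenPresentationForallSingLE 2 p ι J ↔ JOpenPresentationForallSingLE2 p ι J :=
  Iff.rfl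

/-- **`PRung 2 = P2Rung`**: the second rung of this ladder IS the P2 rung statement of record (res-type-073, p512950), so
its assembly `stub_keyRung_dimLETwo` transfers by `Iff`. [OURS · seam · ORDER (o29)] -/
theorem pRung_two_iff (p : ℕ) (ι : (R : Type) → [CommRing R] → R → Ordinal.{0})
    (J : (R : Type) → [CommRing R] → R → ℕ → Ideal R) :
    PRung 2 p ι J ↔ P2Rung p ι J :=
  Iff.rfl

/-- `P3Rung` unfolds to `PRung 3` (by definition). [OURS · seam · ORDER (o29)] -/
theorem p3Rung_iff (p : ℕ) (ι : (R : Type) → [CommRing R] → R → Ordinal.{0})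
    (J : (R : Type) → [CommRing R] → R → ℕ → Ideal R) :
    P3Rung p ι J ↔ PRung 3 p ι J :=
  Iff.rfl

/-- The P3 rung gives the P2 rung (one step down the ladder). [OURS · seam · ORDER (o29)] -/
theorem p2Rung_of_p3Rung (p : ℕ) (ι : (R : Type) → [CommRing R] → R → Ordinal.{0})
    (J : (R : Type) → [CommRing R] → R → ℕ → Ideal R) (h : P3Rung p ι J) : P2Rung p ι J :=
  (pRung_two_iff p ι J).mp (pRung_mono (by norm_num) p ι J h)

end Summit.ResolutionOfSingularities.ResolutionOfSingularities.Cruxes.HypersurfaceCentreConstruction.LocalEngine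

end
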